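import Summits.Ventures.HodgeRepro2.T6N3Assembly

/-!
# T6N3Toy — a toy instance of the N3 datum on which every binder of the N3 mains holds (§10.5(ii)(c)/(d))

Cell pub-hodge-repro2, Tier 6 (README §10), seat t6-p3 (N3 owner, M2). Proof lane; count-neutral. The
referees' non-vacuity protocol (README §10.5(ii)(c)/(d)) asks that the carriers of the hypotheses be
inhabited and that the hypotheses instantiate simultaneously on a toy instance. Here: `toy : N3Datum` with
`L²([H]) = L²([G]) = ℂ`, trivial groups, Schwartz data `ℂ` with `tensor = (·) * (·)`, the theta lift
`Θ φ f := φ · \overline{f}` (conjugate-linear in `f`) and the same for `K_ψ`, `π₀ = σ = ⊤`, one copy (the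
inclusion), the toric period `P_χ = id` on `C([H]) = ℂ`, `F φ_a φ_b := φ_a · φ_b`; then ALL 27 interface Props
of T6N3Interface hold, `hypI` / `hypII` hold, `ellNonzero` holds on both sides, and the three N3 statements
of T6N3Assembly apply (`toy_N3A`, `toy_N3iso`). Nothing here is consumed by the M2 theorem: it is the
kernel witness that the binder set of `N3A_of_datum` / `N3iso_of_datum` is jointly satisfiable (no
hypothesis is contradictory, no carrier empty).

§8(d): uses an L-value-free non-vanishing device: NO.
-/

namespace Summit.Ventures.HodgeRepro2.T6.N3Toy

open scoped InnerProductSpace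
open Summit.Ventures.HodgeRepro2.T6

/-- The conjugate-linear map `f ↦ φ · \overline{f}` on `ℂ`. -/
noncomputable def mulConj (φ : ℂ) : ℂ →ₗ⋆[ℂ] ℂ where
  toFun f := φ * (starRingEnd ℂ) f
  map_add' a b := by simp [mul_add]
  map_smul' c a := by simp [mul_left_comm]

/-- `φ ↦ (f ↦ φ · \overline{f})`, linear in `φ`. -/
noncomputable def thetaToy : ℂ →ₗ[ℂ] (ℂ →ₗ⋆[ℂ] ℂ) where
  toFun φ := mulConj φ
  map_add' a b := LinearMap.ext fun f => by simp [mulConj, add_mul]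
  map_smul' c a := LinearMap.ext fun f => by simp [mulConj, mul_assoc]

/-- `thetaToy φ f = φ · \overline{f}`. -/
lemma thetaToy_apply (φ f : ℂ) : thetaToy φ f = φ * (starRingEnd ℂ) f := rfl

/-- The toy side: everything is `ℂ`, the groups are trivial. -/
noncomputable abbrev side : N3Side ℂ Unit where
  LH := ℂ
  Hf := Unit
  R _ := LinearIsometry.id
  K := ⊤
  Sa := ℂ
  Sb := ℂ
  S := ℂ
  tensor := LinearMap.mul ℂ ℂ
  ωH _ := LinearMap.id
  ωG _ := LinearMap.id
  ωGa _ := LinearMap.id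
  ωGb _ := LinearMap.id
  Θ := thetaToy
  Klift := thetaToy
  σ := ⊤
  π₀ := ⊤
  m₀ := 1
  copy _ := (⊤ : Submodule ℂ ℂ).subtypeₗᵢ
  τ'iso := ⊤
  Cont := ⊤
  Ptor := (⊤ : Submodule ℂ ℂ).subtype
  F := LinearMap.mul ℂ ℂ

/-- The toy datum: `L²([G]) = ℂ`, the trivial group, one automorphic representation (`⊤`), both sides
the toy side. -/
noncomputable abbrev toy : N3Datum where
  LG := ℂ
  Gf := Unit
  ρ _ := LinearIsometry.id
  τiso := ⊤
  Aut := Unit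
  aut _ := ⊤
  A := side
  B := side

/-- `side_Kfix`: the corresponding Prop / identity holds on the toy. -/
lemma side_Kfix : side.Kfix = ⊤ :=
  eq_top_iff.mpr fun _ _ _ _ => rfl

/-- `side_SKfix`: the corresponding Prop / identity holds on the toy. -/
lemma side_SKfix : side.SKfix = ⊤ :=
  eq_top_iff.mpr fun _ _ _ _ => rfl

/-- `side_isotypic`: the corresponding Prop / identity holds on the toy. -/
lemma side_isotypic : side.isotypic = ⊤ := by
  refine eq_top_iff.mpr fun x _ => ?_
  refine Submodule.mem_iSup_of_mem (0 : Fin 1) ?_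
  exact ⟨⟨x, Submodule.mem_top⟩, rfl⟩

/-- `side_levelPart`: the corresponding Prop / identity holds on the toy. -/
lemma side_levelPart : side.levelPart = ⊤ := by
  rw [N3Side.levelPart, side_isotypic, side_Kfix]
  show ⊤ ⊓ ⊤ ⊓ (⊤ : Submodule ℂ ℂ) = ⊤
  simp

/-- Hypothesis (i) on the toy: `f = 1`, `φ = 1`, `Θ 1 1 = 1 ≠ 0`. -/
lemma toy_hypI : side.hypI :=
  ⟨1, ⟨Submodule.mem_top, Submodule.mem_top⟩, 1, by
    show thetaToy 1 1 ≠ 0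
    rw [thetaToy_apply]
    simp⟩

/-- Hypothesis (ii) on the toy: `k = 1 ∈ Π(π₀)^{K,τ′}`, `P_χ(1) = 1 ≠ 0`. -/
lemma toy_hypII : side.hypII :=
  ⟨⟨1, Submodule.mem_top⟩, by rw [side_levelPart]; exact Submodule.mem_top, one_ne_zero⟩

/-- `toy_KliftCont`: the corresponding Prop / identity holds on the toy. -/
lemma toy_KliftCont : side.KliftCont := fun _ _ => Submodule.mem_top

/-- `toy_Seam`: the corresponding Prop / identity holds on the toy. -/
lemma toy_Seam : side.Seam toy_KliftCont := by
  intro φa φb ψ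
  show ⟪ψ, φa * φb⟫_ℂ = thetaToy (φa * φb) ψ
  rw [thetaToy_apply, RCLike.inner_apply, mul_comm]

/-- `toy_Adjoint`: the corresponding Prop / identity holds on the toy. -/
lemma toy_Adjoint : side.Adjoint := by
  intro φ f ψ
  show ⟪f, thetaToy φ ψ⟫_ℂ = ⟪ψ, thetaToy φ f⟫_ℂ
  rw [thetaToy_apply, thetaToy_apply, RCLike.inner_apply, RCLike.inner_apply]
  ring

/-- `toy_KliftLevel`: the corresponding Prop / identity holds on the toy. -/
lemma toy_KliftLevel : side.KliftLevel := fun _ _ _ => ⟨by rw [side_Kfix]; trivial, Submodule.mem_top⟩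

/-- `toy_KliftIsotypic`: the corresponding Prop / identity holds on the toy. -/
lemma toy_KliftIsotypic : side.KliftIsotypic := fun _ _ _ _ => by
  rw [side_isotypic]; trivial

/-- `toy_ThetaMemSigma`: the corresponding Prop / identity holds on the toy. -/
lemma toy_ThetaMemSigma : side.ThetaMemSigma := fun _ _ _ => Submodule.mem_top

/-- `toy_ThetaTauType`: the corresponding Prop / identity holds on the toy. -/
lemma toy_ThetaTauType : side.ThetaTauType (⊤ : Submodule ℂ ℂ) := fun _ _ _ => Submodule.mem_top

/-- `toy_CopiesEquivariant`: the corresponding Prop / identity holds on the toy. -/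
lemma toy_CopiesEquivariant : side.CopiesEquivariant := fun _ _ _ => ⟨Submodule.mem_top, rfl⟩

/-- `toy_CopiesOrthogonal`: the corresponding Prop / identity holds on the toy. -/
lemma toy_CopiesOrthogonal : side.CopiesOrthogonal := fun i j hij => absurd (Subsingleton.elim i j) hij

/-- `toy_CopiesIncl`: the corresponding Prop / identity holds on the toy. -/
lemma toy_CopiesIncl : side.CopiesIncl := ⟨0, fun _ => rfl⟩

/-- `toy_CopiesTauType`: the corresponding Prop / identity holds on the toy. -/
lemma toy_CopiesTauType : side.CopiesTauType := fun _ _ => by simp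

/-- `toy_TauTypeDecomposes`: the corresponding Prop / identity holds on the toy. -/
lemma toy_TauTypeDecomposes : side.TauTypeDecomposes := fun _ _ _ => Submodule.mem_top

/-- `toy_LevelPartFinite`: the corresponding Prop / identity holds on the toy. -/
lemma toy_LevelPartFinite : side.LevelPartFinite := by
  show FiniteDimensional ℂ side.levelPart
  rw [side_levelPart]
  infer_instance

/-- `toy_LevelPartCont`: the corresponding Prop / identity holds on the toy. -/
lemma toy_LevelPartCont : side.LevelPartCont := fun _ _ => Submodule.mem_top

/-- `toy_KAverage`: the corresponding Prop / identity holds on the toy. -/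
lemma toy_KAverage : side.KAverage := fun φ => ⟨φ, by rw [side_SKfix]; trivial, fun _ _ => rfl⟩

/-- `toy_ThetaEquivariant`: the corresponding Prop / identity holds on the toy. -/
lemma toy_ThetaEquivariant : side.ThetaEquivariant := fun _ _ _ => rfl

/-- `toy_SpanOfFixedVector`: the corresponding Prop / identity holds on the toy. -/
lemma toy_SpanOfFixedVector : side.SpanOfFixedVector := by
  intro j u hu hu0 w _
  have hmem : u ∈ Submodule.span ℂ (Set.range fun g : Unit => side.R g u) :=
    Submodule.subset_span ⟨(), rfl⟩
  have : (w / u) • u = w := by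
    rw [smul_eq_mul, div_mul_cancel₀ w hu0]
  rw [← this]
  exact Submodule.smul_mem _ _ hmem

/-- `toy_CrossCopyOrthogonal`: the corresponding Prop / identity holds on the toy. -/
lemma toy_CrossCopyOrthogonal : side.CrossCopyOrthogonal :=
  fun i j hij => absurd (Subsingleton.elim i j) hij

/-- `toy_CopyIndependence`: the corresponding Prop / identity holds on the toy. -/
lemma toy_CopyIndependence : side.CopyIndependence := fun i j _ _ _ _ => by
  rw [Subsingleton.elim i j]

/-- `toy_TensorsSpan`: the corresponding Prop / identity holds on the toy. -/
lemma toy_TensorsSpan : side.TensorsSpan := by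
  intro x _
  have : x ∈ Set.range fun p : ℂ × ℂ => side.tensor p.1 p.2 := ⟨(x, 1), by
    show x * 1 = x
    exact mul_one x⟩
  exact Submodule.subset_span this

/-- (d) for side A / side B: `ellNonzero` on the toy from the three N3 statements. -/
theorem toy_N3A : toy.ellNonzero toy.A :=
  toy.N3A_of_datum toy_KliftCont toy_Seam toy_Adjoint toy_KliftLevel toy_KliftIsotypic
    toy_ThetaMemSigma toy_ThetaTauType toy_CopiesEquivariant toy_CopiesOrthogonal toy_CopiesIncl
    toy_CopiesTauType toy_TauTypeDecomposes toy_LevelPartFinite toy_LevelPartCont toy_KAverage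
    toy_ThetaEquivariant toy_SpanOfFixedVector toy_CrossCopyOrthogonal toy_CopyIndependence
    toy_TensorsSpan toy_hypI toy_hypII

/-- `toy_ProductsIn20`: the corresponding Prop / identity holds on the toy. -/
lemma toy_ProductsIn20 : toy.ProductsIn20 toy.A := fun _ _ => by
  show _ ∈ ⨆ i : Unit, (⊤ : Submodule ℂ ℂ) ⊓ ⊤
  exact Submodule.mem_iSup_of_mem () ⟨Submodule.mem_top, Submodule.mem_top⟩

/-- `toy_ProductEquivariant`: the corresponding Prop / identity holds on the toy. -/
lemma toy_ProductEquivariant : toy.ProductEquivariant toy.A := fun _ _ _ => rfl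

/-- `toy_AutStable`: the corresponding Prop / identity holds on the toy. -/
lemma toy_AutStable : toy.AutStable := fun _ _ _ _ => ⟨Submodule.mem_top, Submodule.mem_top⟩

/-- `toy_AutSimple`: the corresponding Prop / identity holds on the toy. -/
lemma toy_AutSimple : toy.AutSimple := by
  intro i N _ _
  rcases eq_bot_or_eq_top N with h | h
  · exact Or.inl h
  · right
    rw [h]
    simp

/-- `toy_AutNonIso`: the corresponding Prop / identity holds on the toy. -/
lemma toy_AutNonIso : toy.AutNonIso toy_AutStable := fun i j hij => absurd (Subsingleton.elim i j) hij

/-- `toy_AutOrthogonal`: the corresponding Prop / identity holds on the toy. -/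
lemma toy_AutOrthogonal : toy.AutOrthogonal := fun i j hij => absurd (Subsingleton.elim i j) hij

/-- `toy_SigmaIsAut`: the corresponding Prop / identity holds on the toy. -/
lemma toy_SigmaIsAut : toy.SigmaIsAut toy.A := ⟨(), rfl⟩

/-- (d) for the assembly: a single pair of products with a non-zero pairing on the toy. -/
theorem toy_N3iso : ∃ (φa : toy.A.Sa) (φb : toy.A.Sb) (φc : toy.B.Sa) (φd : toy.B.Sb),
    ⟪toy.B.F φc φd, toy.A.F φa φb⟫_ℂ ≠ 0 :=
  toy.N3iso_of_datum toy_AutOrthogonal toy_AutStable toy_AutSimple toy_AutNonIso toy_ProductsIn20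
    toy_ProductEquivariant toy_ProductsIn20 toy_ProductEquivariant toy_SigmaIsAut rfl toy_N3A toy_N3A

end Summit.Ventures.HodgeRepro2.T6.N3Toy
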